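import Literature.ComputerArithmetic.Shewchuk1997.FastExpansionSum
import Literature.ComputerArithmetic.Shewchuk1997.ScaleExpansion
import Mathlib.Algebra.Order.Floor.Ring
import Mathlib.Tactic.Linarith
import Mathlib.Tactic.LinearCombination
import Mathlib.Tactic.Positivity
import Mathlib.Tactic.Ring
import Mathlib.Tactic.NormNum

/-!
# Shewchuk (1997), Appendix B: LINEAR-EXPANSION-SUM (Theorem 24)

J. R. Shewchuk, *Adaptive precision floating-point arithmetic and fast robust geometric
predicates*, Discrete Comput. Geom. 18 (1997) 305–363 [Shewchuk1997], Appendix B "Linear-time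
expansion addition without round-to-even tiebreaking", pp. 360–362: the algorithm
LINEAR-EXPANSION-SUM and its analysis (Theorem 24), the tiebreaking-independent alternative to
FAST-EXPANSION-SUM announced in Appendix A ("If the processor does not use round-to-even
tiebreaking, an algorithm that is independent of the tiebreaking rule, such as the slower
LINEAR-EXPANSION-SUM in Appendix B, might be used instead", p. 360).  Sequel of
`ExpansionArithmetic.lean` (§2.1–2.4: `OnGrid`, `Below`, `IsExpansion`, FAST-TWO-SUM, TWO-SUM,
Lemma 1, Lemma 3 / Corollary 8) and `FastExpansionSum.lean` (§2.4: the merge `mergeExpansions` and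
the grid-invariant proof style of Theorem 13), whose model and dictionary are kept.  As printed
(pp. 360–361):

> **Theorem 24.** Let `e = Σᵢ₌₁^m eᵢ` and `f = Σᵢ₌₁ⁿ fᵢ` be nonoverlapping expansions of `m` and `n`
> `p`-bit components, respectively, where `p ≥ 3`. Suppose that the components of both `e` and `f`
> are sorted in order of increasing magnitude, except that any of the `eᵢ` or `fᵢ` may be zero.
> Then the following algorithm will produce a nonoverlapping expansion `h` such that
> `h = Σᵢ₌₁^{m+n} hᵢ = e + f`, where the components of `h` are also in order of increasing
> magnitude, except that any of the `hᵢ` may be zero.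
> LINEAR-EXPANSION-SUM(e, f): 1 Merge `e` and `f` into a single sequence `g`, in order of
> nondecreasing magnitude (possibly with interspersed zeros); 2 `(Q₂, q₂) ⇐ FAST-TWO-SUM(g₂, g₁)`;
> 3 for `i ⇐ 3` to `m + n`; 4 `(Rᵢ, hᵢ₋₂) ⇐ FAST-TWO-SUM(gᵢ, qᵢ₋₁)`;
> 5 `(Qᵢ, qᵢ) ⇐ TWO-SUM(Qᵢ₋₁, Rᵢ)`; 6 `h_{m+n−1} ⇐ q_{m+n}`; 7 `h_{m+n} ⇐ Q_{m+n}`; 8 return `h`.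
> `Qᵢ + qᵢ` is an approximate sum of the first `i` components of `g`; see Fig. 23. [Caption of
> Fig. 23: `Qᵢ + qᵢ` maintains an approximate running total. The FAST-TWO-SUM operations in the
> bottom row exist to clip a high-order bit off each `qᵢ` term, if necessary, before outputting it.]

MODEL / DICTIONARY (as in `ExpansionArithmetic.lean`, `FastExpansionSum.lean`).
* Floats are `JeannerodRump2018.IsFloat p emin` over `ℚ` (precision `p`, gradual underflow, no
  overflow); `fl` is ANY round-to-nearest map `IsRoundNearest p emin fl` — the whole point of the
  appendix being that no tie rule is assumed; `ulp` is `BoldoJeannerodMelquiondMuller2023.ulp`.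
  Expansions are `List ℚ` from the smallest component; "nonoverlapping and sorted in order of
  increasing magnitude, except that any component may be zero" is `IsExpansion 1` (pairwise
  `Below 1`; `isExpansion_one_iff` is the dictionary with the paper's pairwise `Nonoverlapping`).
* Line 1 is `mergeExpansions` (the stable merge by magnitude of Theorem 13); Lines 3–7 are the
  structural recursion `lesLoop fl ⟨g₃, …, g_{m+n}⟩ Q₂ q₂` (one FAST-TWO-SUM and one TWO-SUM per
  component, then the two accumulator words); LINEAR-EXPANSION-SUM is `linearExpansionSum fl e f`
  (for `m + n ≤ 1` there is no Line 2 and `h = g`).  The tree's `fastTwoSum fl a b`,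
  `twoSum fl a b` ARE the paper's FAST-TWO-SUM(a, b), TWO-SUM(a, b) (Theorems 6, 7).
* "The exponent of `Qᵢ` is at most one greater than the exponent of `gᵢ₊₁`" is typed by its use,
  `|Qᵢ| < 2^(⌊log₂|gᵢ₊₁|⌋ + 2)` (`LesInv.abs_Q_lt`), which gives `ulp(Qᵢ) ≤ 2ulp(gᵢ₊₁)`
  (`ulp_le_two_mul_ulp_of_abs_lt`).

ON THE PROOFS (recorded, not results).  Running the loop of Lines 4–5 from the EMPTY state
`(Q, q) = (0, 0)` over all of `g` emits two zeros and then reaches exactly the state `(Q₂, q₂)` of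
Line 2 (FAST-TWO-SUM(g₂, g₁) = TWO-SUM(g₁, g₂) for `|g₁| ≤ |g₂|` or `g₂ = 0`,
`fastTwoSum_eq_twoSum_of_abs_le`), so `⟨0, 0⟩ ++ LINEAR-EXPANSION-SUM(e, f) = lesLoop g 0 0`
(`lesLoop_merge_zero_zero`) and one induction over the generic loop proves everything.  Its
invariant `LesInv` is the printed pair of inductive hypotheses in the grid form of `FesInv`
(`FastExpansionSum.lean`): the inputs split as processed ++ unprocessed with the processed ones the
smallest; `Q`, `q` floats with `Q = fl(Q + q)` ("`qᵢ₋₁` is the roundoff error of the TWO-SUM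
operation that produces `Qᵢ₋₁`", whence `|q| ≤ ½ulp(Q)` for ANY tie rule, `LesInv.abs_q_le`);
`Q + q + Σ hs = Σ processed` (the printed invariant `Qᵢ + qᵢ + Σⱼ₌₁^{i−2} hⱼ = Σⱼ₌₁^{i} gⱼ`); the
outputs so far form a nonoverlapping increasing expansion of floats; and ONE grid `2^G ∋ Q, q`
lying above every output (`|h| < 2^G`) and not above the unit in the last place of any nonzero
unprocessed component (`2^G ≤ ulp(gⱼ)`, the printed "`|Σⱼ₌₁^{i−2} hⱼ| < ulp(gᵢ) ≤ ulp(gᵢ₊₁)`").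
From the invariant, for the next nonzero component `x`, `E = ⌊log₂|x|⌋`: the processed part of the
expansion containing `x` lies nonoverlapping below `x`, hence sums to `< 2^E`, the processed part
of the other expansion is `≤ |x| < 2^(E+1)` componentwise and sums to `< 2^(E+1)`
(`abs_sum_lt_two_zpow_of_isExpansion`; the printed "`|Σⱼ₌₁ⁱ gⱼ| < 2^p + 2^(p−1)` ... the sum of
`1111.1111…` and `111.1111…`"), and `|Σ hs| < 2^G ≤ ulp(x)`; so `|Q + q| < 3·2^E + ulp(x)` and,
`Q` being `fl(Q + q)`, `|Q| < 2^(E+2)` (`abs_fl_lt_two_zpow_log_add_two`, where `p ≥ 3` enters: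
`3·2^E + ulp(x) ≤ 2^(E+2) − 2^(E+2−p)`, a float; in the subnormal range `|Q + q| ≤ 3·2^E`, a
float).  ONE ITERATION (`LesInv.step`), next component `z ≠ 0` with `ulp(z) = 2^k`:
`|q| ≤ ½ulp(Q) ≤ ulp(z) ≤ |z|` justifies FAST-TWO-SUM(z, q) (Theorem 6: `R = fl(z + q)`,
`h = z + q − R`); `|z + q| < 2^k(2^p + 1)` and Lemma 3 / Corollary 8(a) give `|h| < 2^k = ulp(z)`;
TWO-SUM(Q, R) is exact (Theorem 7), re-establishing `Q' = fl(Q' + q')` and the sum invariant;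
`z, q ∈ 2^G·ℤ` put `R`, `h` on the grid `2^G`, above which no earlier output reaches, so the
earlier outputs lie nonoverlapping below `h`; and the new grid is `2^G` if `h = 0`, else `2^(T+1)`
with `2^T ≤ |h| < 2^(T+1)`: `R ∈ 2^(T+1)·ℤ` because `h` is its roundoff (`below_one_sub_fl`, "too
small to overlap `Rᵢ` because both are produced by a FAST-TWO-SUM operation"), `Q ∈ 2^(T+1)·ℤ`
because `2^T ≤ |h| ≤ |q| ≤ ½ulp(Q)` (Lemma 1, "too small to overlap `Qᵢ₋₁` because
`|hᵢ₋₂| ≤ |qᵢ₋₁|` ... and `|qᵢ₋₁| ≤ ½ulp(Qᵢ₋₁)`"), hence `Q' = fl(Q + R)`, `q' = Q + R − Q'` too,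
and `2^(T+1) ≤ 2^k = ulp(z) ≤ ulp(x)` for every later nonzero `x` ("`|hᵢ₋₂| < ulp(gᵢ)`, which is
bounded in turn by `ulp(gᵢ₊₁)`").  A zero component leaves `(Q, q)` unchanged and outputs `0`
(`lesLoop` with `fastTwoSum_zero_left`, `twoSum_eq_of_fl_add_eq`: the printed last paragraph).  At
the end `⟨…, q, Q⟩` is nonoverlapping because `q = (Q + q) − fl(Q + q)` lies below `Q = fl(Q + q)`
and both lie on the final grid.  The printed normalisation "assume that the exponent of `gᵢ₊₁` is
`p − 1`" is thus undone, intervening zeros are harmless, and gradual underflow is covered.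

PROVED HERE (0 named facts, 0 sorry): the definitions `lesLoop`, `linearExpansionSum`; the
invariant `LesInv` with `LesInv.init`, `LesInv.step`, `LesInv.abs_q_le`, `LesInv.abs_Q_lt`,
`LesInv.isExpansion_lesLoop`; **Theorem 24** as `linearExpansionSum_nonoverlapping` (nonoverlapping
and increasing except zeros = `IsExpansion 1`, `Σ hᵢ = e + f`, `m + n` components, all floats; any
round-to-nearest, any `p ≥ 3`, gradual underflow), with `sum_linearExpansionSum`,
`linearExpansionSum_pairwise_nonoverlapping` (the paper's word "nonoverlapping") and the IEEE
instance `linearExpansionSum_nonoverlapping_roundTiesEven`.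

NOT TYPED: Fig. 23; the running-time comparison with FAST-EXPANSION-SUM and the remarks of
Appendix A (the round-toward-zero examples, the "weakly nonoverlapping" property); whether `p ≥ 3`
is necessary.
-/

namespace Literature.ComputerArithmetic.Shewchuk1997

open Literature.ComputerArithmetic.JeannerodRump2018
open Literature.ComputerArithmetic.BoldoJeannerodMelquiondMuller2023 hiding twoSum
open Literature.ComputerArithmetic.JoldesMullerPopescu2017 (abs_fl_le_of_abs_le)

variable {p : ℕ} {emin : ℤ} {fl : ℚ → ℚ}

/-! ### The algorithm -/

/-- **Lines 3–7 of LINEAR-EXPANSION-SUM** on the remaining merged components `⟨gᵢ, …, g_{m+n}⟩`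
from the accumulator pair `(Qᵢ₋₁, qᵢ₋₁)`: `4. (Rᵢ, hᵢ₋₂) ⇐ FAST-TWO-SUM(gᵢ, qᵢ₋₁)`;
`5. (Qᵢ, qᵢ) ⇐ TWO-SUM(Qᵢ₋₁, Rᵢ)`; after the loop `6. h_{m+n−1} ⇐ q_{m+n}`; `7. h_{m+n} ⇐ Q_{m+n}`
— it returns `⟨hᵢ₋₂, …, h_{m+n−2}, q_{m+n}, Q_{m+n}⟩`.
[cite: Shewchuk1997, Thm 24 p. 361 (algorithm, Lines 3–7)] -/
def lesLoop (fl : ℚ → ℚ) : List ℚ → ℚ → ℚ → List ℚ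
  | [], Q, q => [q, Q]
  | g :: gs, Q, q =>
    (fastTwoSum fl g q).2 ::
      lesLoop fl gs (twoSum fl Q (fastTwoSum fl g q).1).1 (twoSum fl Q (fastTwoSum fl g q).1).2

/-- Lines 6–7: with no component left, output the two accumulator words `q`, `Q`.
[cite: Shewchuk1997, Thm 24 p. 361 (algorithm, Lines 6–7)] -/
@[simp] theorem lesLoop_nil (fl : ℚ → ℚ) (Q q : ℚ) : lesLoop fl [] Q q = [q, Q] := rfl

/-- One iteration of Lines 4–5. [cite: Shewchuk1997, Thm 24 p. 361 (algorithm, Lines 4–5)] -/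
@[simp] theorem lesLoop_cons (fl : ℚ → ℚ) (g : ℚ) (gs : List ℚ) (Q q : ℚ) :
    lesLoop fl (g :: gs) Q q = (fastTwoSum fl g q).2 ::
      lesLoop fl gs (twoSum fl Q (fastTwoSum fl g q).1).1 (twoSum fl Q (fastTwoSum fl g q).1).2 :=
  rfl

/-- The loop over `k` components outputs `k + 2` components.
[cite: Shewchuk1997, Thm 24 p. 361 (algorithm)] -/
theorem length_lesLoop (fl : ℚ → ℚ) (gs : List ℚ) :
    ∀ Q q : ℚ, (lesLoop fl gs Q q).length = gs.length + 2 := by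
  induction gs with
  | nil => intro Q q; rfl
  | cons g gs ih => intro Q q; rw [lesLoop_cons, List.length_cons, ih, List.length_cons]

/-- Every output of the loop is a float (outputs of FAST-TWO-SUM / TWO-SUM, or an accumulator word).
[cite: Shewchuk1997, Thm 24 p. 361 (algorithm)] -/
theorem isFloat_of_mem_lesLoop (hfl : IsRoundNearest p emin fl) (gs : List ℚ) :
    ∀ Q q : ℚ, IsFloat p emin Q → IsFloat p emin q → ∀ x ∈ lesLoop fl gs Q q, IsFloat p emin x := by
  induction gs with
  | nil =>
    intro Q q hQ hq x hx
    rcases List.mem_pair.mp hx with rfl | rfl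
    exacts [hq, hQ]
  | cons g gs ih =>
    intro Q q hQ hq x hx
    rw [lesLoop_cons] at hx
    rcases List.mem_cons.mp hx with rfl | hx
    · exact (isFloat_fastTwoSum hfl _ _).2
    · exact ih _ _ (isFloat_twoSum hfl _ _).1 (isFloat_twoSum hfl _ _).2 x hx

/-- **LINEAR-EXPANSION-SUM(e, f)** (p. 361): `1. merge e and f into g`;
`2. (Q₂, q₂) ⇐ FAST-TWO-SUM(g₂, g₁)`; `3–5. for i ⇐ 3 to m + n: (Rᵢ, hᵢ₋₂) ⇐ FAST-TWO-SUM(gᵢ, qᵢ₋₁);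
(Qᵢ, qᵢ) ⇐ TWO-SUM(Qᵢ₋₁, Rᵢ)`; `6. h_{m+n−1} ⇐ q_{m+n}`; `7. h_{m+n} ⇐ Q_{m+n}`; `8. return h`.
(For fewer than two components in total there is no Line 2 and `h = g`.)
[cite: Shewchuk1997, Thm 24 p. 360–361 (algorithm p. 361)] -/
def linearExpansionSum (fl : ℚ → ℚ) (e f : List ℚ) : List ℚ :=
  match mergeExpansions e f with
  | [] => []
  | [g₁] => [g₁]
  | g₁ :: g₂ :: gs => lesLoop fl gs (fastTwoSum fl g₂ g₁).1 (fastTwoSum fl g₂ g₁).2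

/-- `h` has `m + n` components. [cite: Shewchuk1997, Thm 24 p. 361] -/
theorem length_linearExpansionSum (fl : ℚ → ℚ) (e f : List ℚ) :
    (linearExpansionSum fl e f).length = e.length + f.length := by
  have hlen := length_mergeExpansions e f
  rcases hm : mergeExpansions e f with _ | ⟨g₁, _ | ⟨g₂, gs⟩⟩
  · rw [hm] at hlen; simp only [linearExpansionSum, hm]; simpa using hlen
  · rw [hm] at hlen; simp only [linearExpansionSum, hm]; simpa using hlen
  · rw [hm] at hlen
    simp only [linearExpansionSum, hm, length_lesLoop]
    simp only [List.length_cons] at hlen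
    omega

/-- Every component of `h` is a float. [cite: Shewchuk1997, Thm 24 p. 361] -/
theorem isFloat_of_mem_linearExpansionSum (hfl : IsRoundNearest p emin fl) {e f : List ℚ}
    (heF : ∀ x ∈ e, IsFloat p emin x) (hfF : ∀ x ∈ f, IsFloat p emin x) :
    ∀ x ∈ linearExpansionSum fl e f, IsFloat p emin x := by
  have hgF : ∀ x ∈ mergeExpansions e f, IsFloat p emin x := fun x hx =>
    (mem_mergeExpansions.mp hx).elim (heF x) (hfF x)
  rcases hm : mergeExpansions e f with _ | ⟨g₁, _ | ⟨g₂, gs⟩⟩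
  · simp [linearExpansionSum, hm]
  · rw [hm] at hgF; simpa [linearExpansionSum, hm] using hgF
  · simp only [linearExpansionSum, hm]
    exact isFloat_of_mem_lesLoop hfl gs _ _ (isFloat_fastTwoSum hfl _ _).1
      (isFloat_fastTwoSum hfl _ _).2

/-! ### Zero components and the start of the loop -/

/-- FAST-TWO-SUM(a, 0) = (a, 0) for a float `a`. [cite: Shewchuk1997, Thm 24 p. 362 (proof, last
paragraph); Thm 6 p. 312] -/
theorem fastTwoSum_zero_right (hp : 1 ≤ p) (hfl : IsRoundNearest p emin fl) {a : ℚ}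
    (ha : IsFloat p emin a) : fastTwoSum fl a 0 = (a, 0) :=
  (fastTwoSum_eq_twoSum_of_abs_le hp hfl (isFloat_zero p emin) ha
    (Or.inl (by rw [abs_zero]; exact abs_nonneg a))).trans (twoSum_zero_left hfl ha)

/-- TWO-SUM(Q, q) = (Q, q) when `Q = fl(Q + q)` (`q` is already the roundoff of `Q + q`): the
accumulator pair absorbs its own low word unchanged. [cite: Shewchuk1997, Thm 24 p. 362 (proof,
last paragraph); Thm 7 p. 314] -/
theorem twoSum_eq_of_fl_add_eq (hfl : IsRoundNearest p emin fl) {Q q : ℚ} (hQ : IsFloat p emin Q)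
    (hq : IsFloat p emin q) (hfix : fl (Q + q) = Q) : twoSum fl Q q = (Q, q) := by
  have h0 : fl 0 = 0 := fl_zero hfl
  have hQ' : fl Q = Q := fl_eq_self hfl hQ
  have hq' : fl q = q := fl_eq_self hfl hq
  show (fl (Q + q), fl (fl (Q - fl (fl (Q + q) - fl (fl (Q + q) - Q))) +
      fl (q - fl (fl (Q + q) - Q)))) = (Q, q)
  simp only [hfix, sub_self, h0, sub_zero, hQ', hq', zero_add]

/-- **ZERO COMPONENTS** ("If any of the `gᵢ` is zero, the corresponding output component `hᵢ₋₂` is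
also zero, and the accumulator values `Q` and `q` are unchanged"): for a state with `Q = fl(Q + q)`.
[cite: Shewchuk1997, Thm 24 p. 362 (proof, last paragraph)] -/
theorem lesLoop_cons_zero (hfl : IsRoundNearest p emin fl) {Q q : ℚ} (hQ : IsFloat p emin Q)
    (hq : IsFloat p emin q) (hfix : fl (Q + q) = Q) (gs : List ℚ) :
    lesLoop fl (0 :: gs) Q q = 0 :: lesLoop fl gs Q q := by
  simp only [lesLoop_cons, fastTwoSum_zero_left hfl hq, twoSum_eq_of_fl_add_eq hfl hQ hq hfix]

/-- **LINE 2 VERSUS THE LOOP.**  Run from the empty state `(Q, q) = (0, 0)` over ALL of `g`, the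
loop of Lines 4–5 first outputs two zeros while its accumulator becomes `(g₁, 0)` and then
`TWO-SUM(g₁, g₂) = FAST-TWO-SUM(g₂, g₁) = (Q₂, q₂)` (the inputs being floats sorted by magnitude
except zeros, `|g₁| ≤ |g₂|` or `g₂ = 0`); so `lesLoop g 0 0 = ⟨0, 0⟩ ++ LINEAR-EXPANSION-SUM(e, f)`.
[cite: Shewchuk1997, Thm 24 p. 361 (algorithm, Line 2; "this invariant holds for i = 2 after
Line 2 is executed")] -/
theorem lesLoop_merge_zero_zero (hp : 1 ≤ p) (hfl : IsRoundNearest p emin fl) {e f : List ℚ}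
    (heF : ∀ x ∈ e, IsFloat p emin x) (hfF : ∀ x ∈ f, IsFloat p emin x)
    (he : e.Pairwise fun a b => b ≠ 0 → |a| ≤ |b|) (hf : f.Pairwise fun a b => b ≠ 0 → |a| ≤ |b|) :
    lesLoop fl (mergeExpansions e f) 0 0 = 0 :: 0 :: linearExpansionSum fl e f := by
  have hgF : ∀ x ∈ mergeExpansions e f, IsFloat p emin x := fun x hx =>
    (mem_mergeExpansions.mp hx).elim (heF x) (hfF x)
  have h0 : IsFloat p emin (0 : ℚ) := isFloat_zero p emin
  rcases hm : mergeExpansions e f with _ | ⟨g₁, _ | ⟨g₂, gs⟩⟩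
  · simp [linearExpansionSum, hm]
  · rw [hm] at hgF
    have h₁ : IsFloat p emin g₁ := hgF g₁ (List.mem_singleton_self _)
    simp only [linearExpansionSum, hm, lesLoop_cons, lesLoop_nil, fastTwoSum_zero_right hp hfl h₁,
      twoSum_zero_left hfl h₁]
  · rw [hm] at hgF
    have h₁ : IsFloat p emin g₁ := hgF g₁ List.mem_cons_self
    have h₂ : IsFloat p emin g₂ := hgF g₂ (List.mem_cons_of_mem _ List.mem_cons_self)
    have hle : |g₁| ≤ |g₂| ∨ g₂ = 0 := by
      by_cases hg₂ : g₂ = 0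
      · exact Or.inr hg₂
      · exact Or.inl (mergeExpansions_head_le he hf hm hg₂)
    simp only [linearExpansionSum, hm, lesLoop_cons, fastTwoSum_zero_right hp hfl h₁,
      fastTwoSum_zero_right hp hfl h₂, twoSum_zero_left hfl h₁,
      fastTwoSum_eq_twoSum_of_abs_le hp hfl h₁ h₂ hle]

/-- A (`c ≥ 1`)-expansion is sorted by magnitude except for zeros.
[cite: Shewchuk1997, Thm 24 p. 360–361 ("sorted in order of increasing magnitude, except that any
of the eᵢ or fᵢ may be zero")] -/
theorem IsExpansion.pairwise_abs_le {c : ℚ} {l : List ℚ} (h : IsExpansion c l) (hc : 1 ≤ c) :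
    l.Pairwise fun a b => b ≠ 0 → |a| ≤ |b| :=
  List.Pairwise.imp (fun hab hb => (hab.abs_lt hc hb).le) h

/-! ### Magnitude facts -/

/-- A float lies on the grid of its own unit in the last place, a power of two `≥ 2^emin`.
[cite: Shewchuk1997, Thm 24 p. 362 (proof: "|qᵢ₋₁| ≤ ulp(gᵢ), which justifies the use of a
FAST-TWO-SUM operation")] -/
theorem exists_ulp_eq_two_zpow_and_onGrid {x : ℚ} (hx : IsFloat p emin x) :
    ∃ k : ℤ, emin ≤ k ∧ ulp p emin x = (2 : ℚ) ^ k ∧ OnGrid k x := by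
  obtain ⟨k, hk, hu⟩ := exists_ulp_eq_two_zpow (p := p) (emin := emin) x
  obtain ⟨K, hK⟩ := exists_eq_int_mul_ulp_of_isFloat hx
  exact ⟨k, hk, hu, ⟨K, by rw [← hu]; exact hK⟩⟩

/-- "The exponent of `Q` is at most one greater than the exponent of `x`" in ulp form: if
`|Q| < 2^(⌊log₂|x|⌋ + 2)` (`x ≠ 0`) then `ulp(Q) ≤ 2ulp(x)`.
[cite: Shewchuk1997, Thm 24 p. 361–362 (proof)] -/
theorem ulp_le_two_mul_ulp_of_abs_lt {Q x : ℚ} (hx0 : x ≠ 0)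
    (hQ : |Q| < (2 : ℚ) ^ (Int.log 2 |x| + 2)) : ulp p emin Q ≤ 2 * ulp p emin x := by
  have hux : 0 < ulp p emin x := ulp_pos x
  by_cases hQ0 : Q = 0
  · rw [hQ0, ulp_zero]; linarith [two_zpow_emin_le_ulp (p := p) (emin := emin) x]
  · have hlog : Int.log 2 |Q| < Int.log 2 |x| + 2 :=
      (Int.lt_zpow_iff_log_lt (by norm_num) (abs_pos.mpr hQ0)).mp (by exact_mod_cast hQ)
    have h1 : max emin (Int.log 2 |Q| - p + 1) ≤ max emin (Int.log 2 |x| - p + 1) + 1 := by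
      rcases le_total emin (Int.log 2 |Q| - p + 1) with h | h
      · rw [max_eq_right h]; have := le_max_right emin (Int.log 2 |x| - p + 1); omega
      · rw [max_eq_left h]; have := le_max_left emin (Int.log 2 |x| - p + 1); omega
    rw [ulp_of_ne_zero hQ0, ulp_of_ne_zero hx0]
    calc (2 : ℚ) ^ max emin (Int.log 2 |Q| - p + 1)
        ≤ (2 : ℚ) ^ (max emin (Int.log 2 |x| - p + 1) + 1) := zpow_le_zpow_right₀ (by norm_num) h1
      _ = 2 * (2 : ℚ) ^ max emin (Int.log 2 |x| - p + 1) := by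
        rw [zpow_add_one₀ (by norm_num : (2 : ℚ) ≠ 0)]; ring

/-- **THE EXPONENT BOUND ON THE ACCUMULATOR** (where `p ≥ 3` is used).  If `x ≠ 0` is a float with
`⌊log₂|x|⌋ = E` and `t ∈ 2^emin·ℤ` satisfies `|t| < 3·2^E + ulp(x)`, then `|fl(t)| < 2^(E+2)`:
in the normal range `3·2^E + ulp(x) ≤ 2^(E+2) − 2^(E+2−p)`, the largest float below `2^(E+2)`
(that is, `2^(3−p) ≤ 1`); in the subnormal range `ulp(x) = 2^emin` and `|t| ≤ 3·2^E`, a float.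
The printed form: "`|Qᵢ + qᵢ| < 2^p + 2^(p−1) + 1`, which confirms that the exponent of `Qᵢ` is at
most one greater than the exponent of `gᵢ₊₁`" (there `ulp(gᵢ₊₁) = 1`, `E = p − 1`).
[cite: Shewchuk1997, Thm 24 p. 362 (proof)] -/
theorem abs_fl_lt_two_zpow_log_add_two (hp : 3 ≤ p) (hfl : IsRoundNearest p emin fl) {x t : ℚ}
    (hx : IsFloat p emin x) (hx0 : x ≠ 0) (ht : OnGrid emin t)
    (hlt : |t| < 3 * (2 : ℚ) ^ Int.log 2 |x| + ulp p emin x) :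
    |fl t| < (2 : ℚ) ^ (Int.log 2 |x| + 2) := by
  set E : ℤ := Int.log 2 |x| with hE
  have h2 : (0 : ℚ) < 2 := by norm_num
  have h2E : (0 : ℚ) < (2 : ℚ) ^ E := zpow_pos h2 E
  have hxE1 : |x| < (2 : ℚ) ^ (E + 1) := abs_lt_zpow_log_succ x
  have heminE : emin ≤ E := by
    have hge : (2 : ℚ) ^ emin ≤ |x| := (OnGrid.of_isFloat hx).two_zpow_le_abs hx0
    have := (zpow_lt_zpow_iff_right₀ (by norm_num : (1 : ℚ) < 2)).mp (lt_of_le_of_lt hge hxE1)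
    omega
  have h4 : (2 : ℚ) ^ (E + 2) = 4 * (2 : ℚ) ^ E := by
    rw [show E + 2 = E + 1 + 1 by ring, zpow_add_one₀ h2.ne', zpow_add_one₀ h2.ne']; ring
  rw [h4]
  by_cases hcase : emin ≤ E + 2 - p
  · -- normal range: `|t| ≤ 2^(E+2) − 2^(E+2−p)`, a float
    have hu : ulp p emin x ≤ (2 : ℚ) ^ (E + 2 - p) := by
      rw [ulp_of_ne_zero hx0, ← hE]
      refine zpow_le_zpow_right₀ (by norm_num) ?_
      rcases le_total emin (E - p + 1) with h | h
      · rw [max_eq_right h]; omega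
      · rw [max_eq_left h]; omega
    have h8 : 2 * (2 : ℚ) ^ (E + 2 - p) ≤ (2 : ℚ) ^ E :=
      calc 2 * (2 : ℚ) ^ (E + 2 - p) = (2 : ℚ) ^ (E + 2 - p + 1) := by
            rw [zpow_add_one₀ h2.ne']; ring
        _ ≤ (2 : ℚ) ^ E := zpow_le_zpow_right₀ (by norm_num) (by omega)
    have hpE : (2 : ℚ) ^ (p : ℤ) * (2 : ℚ) ^ (E + 2 - p) = 4 * (2 : ℚ) ^ E := by
      rw [← h4, ← zpow_add₀ h2.ne']; congr 1; ring
    have hF : IsFloat p emin ((((2 : ℤ) ^ p - 1 : ℤ) : ℚ) * (2 : ℚ) ^ (E + 2 - p)) := by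
      refine isFloat_of_int_mul _ _ ?_ hcase
      have : (0 : ℤ) < 2 ^ p := by positivity
      rw [abs_of_nonneg (by omega)]; omega
    have hFeq : (((2 : ℤ) ^ p - 1 : ℤ) : ℚ) * (2 : ℚ) ^ (E + 2 - p) =
        4 * (2 : ℚ) ^ E - (2 : ℚ) ^ (E + 2 - p) := by
      push_cast
      rw [sub_mul, one_mul, ← zpow_natCast, hpE]
    rw [hFeq] at hF
    have hle : |t| ≤ 4 * (2 : ℚ) ^ E - (2 : ℚ) ^ (E + 2 - p) := by linarith
    have := abs_fl_le_of_abs_le hfl hF hle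
    have h2Ep : (0 : ℚ) < (2 : ℚ) ^ (E + 2 - p) := zpow_pos h2 _
    linarith
  · -- subnormal range: `ulp(x) = 2^emin` and `|t| ≤ 3·2^E`, a float
    have hu : ulp p emin x = (2 : ℚ) ^ emin := by
      rw [ulp_of_ne_zero hx0, ← hE, max_eq_left (by omega)]
    have hEg : OnGrid emin ((2 : ℚ) ^ E) := OnGrid.two_zpow heminE
    have h3g : OnGrid emin (3 * (2 : ℚ) ^ E) := by
      have h := (hEg.add hEg).add hEg
      convert h using 1
      ring
    have hle : |t| ≤ 3 * (2 : ℚ) ^ E := by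
      by_contra hgt
      have := OnGrid.add_two_zpow_le h3g ht.abs (not_le.mp hgt)
      rw [hu] at hlt
      linarith
    have hF : IsFloat p emin (((3 : ℤ) : ℚ) * (2 : ℚ) ^ E) := by
      refine isFloat_of_int_mul _ _ ?_ heminE
      have h4p : (4 : ℤ) ≤ 2 ^ p := by
        calc (4 : ℤ) = 2 ^ 2 := by norm_num
          _ ≤ 2 ^ p := pow_le_pow_right₀ (by norm_num) (by omega)
      rw [abs_of_nonneg (by norm_num)]; omega
    push_cast at hF
    have := abs_fl_le_of_abs_le hfl hF hle
    linarith

/-- In a nonoverlapping increasing expansion `e₁ ++ e₂` of floats, the components before a nonzero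
component `x ∈ e₂` sum to less than `2^⌊log₂|x|⌋` (each lies nonoverlapping below `x`, hence below
`x`'s lowest set bit; the printed "`111.1111…`" below `gᵢ₊₁ = 1000`).
[cite: Shewchuk1997, Thm 24 p. 362 (proof)] -/
theorem abs_sum_lt_two_zpow_log_of_isExpansion_append {e₁ e₂ : List ℚ} {x : ℚ}
    (hF : ∀ y ∈ e₁ ++ e₂, IsFloat p emin y) (hexp : IsExpansion 1 (e₁ ++ e₂)) (hx : x ∈ e₂)
    (hx0 : x ≠ 0) : |e₁.sum| < (2 : ℚ) ^ Int.log 2 |x| := by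
  rw [IsExpansion, List.pairwise_append] at hexp
  have he₁F : ∀ y ∈ e₁, IsFloat p emin y := fun y hy => hF y (List.mem_append_left _ hy)
  refine abs_sum_lt_two_zpow_of_isExpansion he₁F hexp.1 fun y hy => ?_
  obtain ⟨s, hs, hlt⟩ := hexp.2.2 y hy x hx
  rw [one_mul] at hlt
  have h2s : (2 : ℚ) ^ s ≤ |x| := hs.two_zpow_le_abs hx0
  have hsE : s ≤ Int.log 2 |x| := by
    have := (zpow_lt_zpow_iff_right₀ (by norm_num : (1 : ℚ) < 2)).mp
      (lt_of_le_of_lt h2s (abs_lt_zpow_log_succ x))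
    omega
  exact lt_of_lt_of_le hlt (zpow_le_zpow_right₀ (by norm_num) hsE)

/-! ### The induction behind Theorem 24 -/

/-- The INDUCTION INVARIANT of the proof of Theorem 24 (state after some iterations of Lines 2–5,
in the grid form of `FesInv`): the inputs split as processed ++ unprocessed (`e = e₁ ++ e₂`,
`f = f₁ ++ f₂`, the processed components being the smallest), the accumulator words `Q`, `q` are
floats with `Q = fl(Q + q)` ("`qᵢ₋₁` is the roundoff error of the TWO-SUM operation that produces
`Qᵢ₋₁`") and `Q + q + Σ hs = Σ e₁ + Σ f₁` (the printed invariant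
`Qᵢ + qᵢ + Σⱼ₌₁^{i−2} hⱼ = Σⱼ₌₁^{i} gⱼ`), the outputs so far `hs` are floats forming a
nonoverlapping increasing expansion, and there is ONE grid `2^G ∋ Q, q` above every output
(`|h| < 2^G`) and not coarser than the unit in the last place of any nonzero unprocessed component
(`2^G ≤ ulp(gⱼ)`:
"`|Σⱼ₌₁^{i−2} hⱼ| < ulp(gᵢ) ≤ ulp(gᵢ₊₁)`"). [cite: Shewchuk1997, Thm 24 p. 361–362 (proof)] -/
structure LesInv (p : ℕ) (emin : ℤ) (fl : ℚ → ℚ) (e f e₁ f₁ e₂ f₂ : List ℚ) (Q q : ℚ)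
    (hs : List ℚ) (G : ℤ) : Prop where
  he : e = e₁ ++ e₂
  hf : f = f₁ ++ f₂
  hQ : IsFloat p emin Q
  hq : IsFloat p emin q
  hfix : fl (Q + q) = Q
  hsum : Q + q + hs.sum = e₁.sum + f₁.sum
  hle : ∀ y ∈ e₁ ++ f₁, ∀ x ∈ e₂ ++ f₂, x ≠ 0 → |y| ≤ |x|
  hhs : ∀ h ∈ hs, IsFloat p emin h
  hexp : IsExpansion 1 hs
  hG : emin ≤ G
  hQG : OnGrid G Q
  hqG : OnGrid G q
  hhG : ∀ h ∈ hs, |h| < (2 : ℚ) ^ G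
  hGulp : ∀ x ∈ e₂ ++ f₂, x ≠ 0 → (2 : ℚ) ^ G ≤ ulp p emin x

/-- The invariant is symmetric in the two input expansions.
[cite: Shewchuk1997, Thm 24 p. 361–362 (proof)] -/
theorem LesInv.swap {e f e₁ f₁ e₂ f₂ : List ℚ} {Q q : ℚ} {hs : List ℚ} {G : ℤ}
    (hI : LesInv p emin fl e f e₁ f₁ e₂ f₂ Q q hs G) :
    LesInv p emin fl f e f₁ e₁ f₂ e₂ Q q hs G where
  he := hI.hf
  hf := hI.he
  hQ := hI.hQ
  hq := hI.hq
  hfix := hI.hfix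
  hsum := by rw [hI.hsum, add_comm]
  hle := fun y hy x hx => hI.hle y (by rw [List.mem_append] at hy ⊢; tauto) x
    (by rw [List.mem_append] at hx ⊢; tauto)
  hhs := hI.hhs
  hexp := hI.hexp
  hG := hI.hG
  hQG := hI.hQG
  hqG := hI.hqG
  hhG := hI.hhG
  hGulp := fun x hx => hI.hGulp x (by rw [List.mem_append] at hx ⊢; tauto)

/-- The empty initial state (nothing processed, `(Q, q) = (0, 0)`, grid `2^emin`), from which the
loop reproduces Line 2 (`lesLoop_merge_zero_zero`). [cite: Shewchuk1997, Thm 24 p. 361 (proof)] -/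
theorem LesInv.init (hfl : IsRoundNearest p emin fl) (e f : List ℚ) :
    LesInv p emin fl e f [] [] e f 0 0 [] emin where
  he := rfl
  hf := rfl
  hQ := isFloat_zero p emin
  hq := isFloat_zero p emin
  hfix := by rw [add_zero]; exact fl_zero hfl
  hsum := by simp
  hle := fun y hy => by simp at hy
  hhs := fun h hh => by simp at hh
  hexp := isExpansion_nil 1
  hG := le_rfl
  hQG := OnGrid.zero emin
  hqG := OnGrid.zero emin
  hhG := fun h hh => by simp at hh
  hGulp := fun x _ _ => two_zpow_emin_le_ulp x

/-- Every unprocessed component lies on the grid `2^G` (a float is a multiple of its ulp).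
[cite: Shewchuk1997, Thm 24 p. 362 (proof)] -/
theorem LesInv.onGrid_of_mem {e f e₁ f₁ e₂ f₂ : List ℚ} {Q q : ℚ} {hs : List ℚ} {G : ℤ}
    (hI : LesInv p emin fl e f e₁ f₁ e₂ f₂ Q q hs G)
    (heF : ∀ x ∈ e, IsFloat p emin x) (hfF : ∀ x ∈ f, IsFloat p emin x)
    {x : ℚ} (hx : x ∈ e₂ ++ f₂) : OnGrid G x := by
  by_cases hx0 : x = 0
  · rw [hx0]; exact OnGrid.zero G
  · have hxF : IsFloat p emin x := (List.mem_append.mp hx).elim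
      (fun h => heF x (by rw [hI.he]; exact List.mem_append_right _ h))
      (fun h => hfF x (by rw [hI.hf]; exact List.mem_append_right _ h))
    obtain ⟨k, -, hku, hxk⟩ := exists_ulp_eq_two_zpow_and_onGrid hxF
    have := hI.hGulp x hx hx0
    rw [hku] at this
    exact hxk.mono ((zpow_le_zpow_iff_right₀ (by norm_num : (1 : ℚ) < 2)).mp this)

/-- "`qᵢ₋₁` is the roundoff error of the TWO-SUM operation that produces `Qᵢ₋₁`, so
`|qᵢ₋₁| ≤ ½ulp(Qᵢ₋₁)`" — for ANY round-to-nearest, from `Q = fl(Q + q)`.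
[cite: Shewchuk1997, Thm 24 p. 362 (proof)] -/
theorem LesInv.abs_q_le (hp : 1 ≤ p) (hfl : IsRoundNearest p emin fl)
    {e f e₁ f₁ e₂ f₂ : List ℚ} {Q q : ℚ} {hs : List ℚ} {G : ℤ}
    (hI : LesInv p emin fl e f e₁ f₁ e₂ f₂ Q q hs G) : |q| ≤ ulp p emin Q / 2 := by
  have := abs_sub_fl_le_half_ulp_fl hp hfl (Q + q)
  rwa [hI.hfix, add_sub_cancel_left] at this

/-- "Because `g` is formed by merging two nonoverlapping increasing expansions,
`|Σⱼ₌₁ⁱ gⱼ| < 2^p + 2^(p−1)`": the processed components sum to less than `3·2^E`,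
`E = ⌊log₂|x|⌋`, for every nonzero unprocessed component `x` of `e` (and, by `swap`, of `f`).
[cite: Shewchuk1997, Thm 24 p. 362 (proof)] -/
theorem LesInv.abs_sum_processed_lt {e f e₁ f₁ e₂ f₂ : List ℚ} {Q q : ℚ} {hs : List ℚ} {G : ℤ}
    (hI : LesInv p emin fl e f e₁ f₁ e₂ f₂ Q q hs G)
    (heF : ∀ x ∈ e, IsFloat p emin x) (hee : IsExpansion 1 e)
    (hfF : ∀ x ∈ f, IsFloat p emin x) (hfe : IsExpansion 1 f)
    {x : ℚ} (hx : x ∈ e₂) (hx0 : x ≠ 0) :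
    |e₁.sum + f₁.sum| < 3 * (2 : ℚ) ^ Int.log 2 |x| := by
  have h1 : |e₁.sum| < (2 : ℚ) ^ Int.log 2 |x| :=
    abs_sum_lt_two_zpow_log_of_isExpansion_append (by rw [← hI.he]; exact heF)
      (by rw [← hI.he]; exact hee) hx hx0
  have hf₁F : ∀ y ∈ f₁, IsFloat p emin y := fun y hy =>
    hfF y (by rw [hI.hf]; exact List.mem_append_left _ hy)
  have hf₁e : IsExpansion 1 f₁ :=
    List.Pairwise.sublist (by rw [hI.hf]; exact List.sublist_append_left f₁ f₂) hfe
  have h2 : |f₁.sum| < (2 : ℚ) ^ (Int.log 2 |x| + 1) :=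
    abs_sum_lt_two_zpow_of_isExpansion hf₁F hf₁e fun y hy =>
      lt_of_le_of_lt (hI.hle y (List.mem_append_right _ hy) x (List.mem_append_left _ hx) hx0)
        (abs_lt_zpow_log_succ x)
  rw [zpow_add_one₀ (by norm_num : (2 : ℚ) ≠ 0)] at h2
  calc |e₁.sum + f₁.sum| ≤ |e₁.sum| + |f₁.sum| := abs_add_le _ _
    _ < (2 : ℚ) ^ Int.log 2 |x| + (2 : ℚ) ^ Int.log 2 |x| * 2 := by linarith
    _ = 3 * (2 : ℚ) ^ Int.log 2 |x| := by ring

/-- **"The exponent of `Qᵢ` is at most one greater than the exponent of `gᵢ₊₁`"**: for every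
nonzero unprocessed component `x`, `|Q| < 2^(⌊log₂|x|⌋ + 2)` — from the sum invariant,
`|Σ processed| < 3·2^E`, `|Σ hs| < 2^G ≤ ulp(x)` and `Q = fl(Q + q)` (`p ≥ 3`).
[cite: Shewchuk1997, Thm 24 p. 361–362 (proof)] -/
theorem LesInv.abs_Q_lt (hp : 3 ≤ p) (hfl : IsRoundNearest p emin fl)
    {e f e₁ f₁ e₂ f₂ : List ℚ} {Q q : ℚ} {hs : List ℚ} {G : ℤ}
    (hI : LesInv p emin fl e f e₁ f₁ e₂ f₂ Q q hs G)
    (heF : ∀ x ∈ e, IsFloat p emin x) (hee : IsExpansion 1 e)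
    (hfF : ∀ x ∈ f, IsFloat p emin x) (hfe : IsExpansion 1 f)
    {x : ℚ} (hx : x ∈ e₂ ++ f₂) (hx0 : x ≠ 0) :
    |Q| < (2 : ℚ) ^ (Int.log 2 |x| + 2) := by
  have hxF : IsFloat p emin x := (List.mem_append.mp hx).elim
    (fun h => heF x (by rw [hI.he]; exact List.mem_append_right _ h))
    (fun h => hfF x (by rw [hI.hf]; exact List.mem_append_right _ h))
  have hproc : |e₁.sum + f₁.sum| < 3 * (2 : ℚ) ^ Int.log 2 |x| := by
    rcases List.mem_append.mp hx with hx | hx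
    · exact hI.abs_sum_processed_lt heF hee hfF hfe hx hx0
    · have := hI.swap.abs_sum_processed_lt hfF hfe heF hee hx hx0
      rwa [add_comm] at this
  have hS : |hs.sum| < (2 : ℚ) ^ G := abs_sum_lt_two_zpow_of_isExpansion hI.hhs hI.hexp hI.hhG
  have hGu : (2 : ℚ) ^ G ≤ ulp p emin x := hI.hGulp x hx hx0
  have hQq : Q + q = (e₁.sum + f₁.sum) - hs.sum := by have := hI.hsum; linear_combination this
  have ht : |Q + q| < 3 * (2 : ℚ) ^ Int.log 2 |x| + ulp p emin x := by
    rw [hQq]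
    calc |e₁.sum + f₁.sum - hs.sum| ≤ |e₁.sum + f₁.sum| + |hs.sum| := abs_sub _ _
      _ < 3 * (2 : ℚ) ^ Int.log 2 |x| + ulp p emin x := by linarith
  have hgrid : OnGrid emin (Q + q) := (OnGrid.of_isFloat hI.hQ).add (OnGrid.of_isFloat hI.hq)
  have := abs_fl_lt_two_zpow_log_add_two hp hfl hxF hx0 hgrid ht
  rwa [hI.hfix] at this

/-- **ONE ITERATION (Lines 4–5), the heart of the proof of Theorem 24**: processing the next
component `z` (here the head of the unprocessed part of `e`, not exceeding the unprocessed nonzero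
components of `f`) re-establishes the invariant — for `z = 0` nothing moves and the output is `0`;
for `z ≠ 0`, `ulp(z) = 2^k`: `|q| ≤ ½ulp(Q) ≤ ulp(z) ≤ |z|` "justifies the use of a FAST-TWO-SUM
operation in Line 4. This operation produces the sum `|Rᵢ + hᵢ₋₂| = |gᵢ + qᵢ₋₁| < (2^p + 1)ulp(gᵢ)`.
Corollary 8(a) implies that `|hᵢ₋₂| < ulp(gᵢ)`"; TWO-SUM(Q, R) is exact; the earlier outputs lie
below `h` through the grid `2^G ∋ h`; and the new grid is `2^G` (`h = 0`) or `2^(⌊log₂|h|⌋+1)`,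
which contains `R` (its roundoff is `h`), `Q` (`|h| ≤ |q| ≤ ½ulp(Q)`: "`hᵢ₋₂` is too small to
overlap `Rᵢ` ... too small to overlap `Qᵢ₋₁`"), hence `Q'`, `q'`, and divides the ulp of every
later nonzero component. [cite: Shewchuk1997, Thm 24 p. 362 (proof)] -/
theorem LesInv.step (hp : 3 ≤ p) (hfl : IsRoundNearest p emin fl)
    {e f e₁ f₁ e₂' f₂ : List ℚ} {z Q q : ℚ} {hs : List ℚ} {G : ℤ}
    (heF : ∀ x ∈ e, IsFloat p emin x) (hee : IsExpansion 1 e)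
    (hfF : ∀ x ∈ f, IsFloat p emin x) (hfe : IsExpansion 1 f)
    (hI : LesInv p emin fl e f e₁ f₁ (z :: e₂') f₂ Q q hs G) (hzle : ∀ x ∈ f₂, x ≠ 0 → |z| ≤ |x|) :
    ∃ G' : ℤ, LesInv p emin fl e f (e₁ ++ [z]) f₁ e₂' f₂
      (twoSum fl Q (fastTwoSum fl z q).1).1 (twoSum fl Q (fastTwoSum fl z q).1).2
      (hs ++ [(fastTwoSum fl z q).2]) G' := by
  have hp1 : 1 ≤ p := le_trans (by norm_num) hp
  have h2 : (0 : ℚ) < 2 := by norm_num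
  have hzef : z ∈ (z :: e₂') ++ f₂ := List.mem_append_left _ List.mem_cons_self
  have hze : z ∈ e := by rw [hI.he]; exact List.mem_append_right _ List.mem_cons_self
  have hzF : IsFloat p emin z := heF z hze
  -- bookkeeping valid in all cases
  have he' : e = (e₁ ++ [z]) ++ e₂' := by rw [hI.he]; simp
  have hsub : ∀ x ∈ e₂' ++ f₂, x ∈ (z :: e₂') ++ f₂ := fun x hx =>
    (List.mem_append.mp hx).elim (fun hx => List.mem_append_left _ (List.mem_cons_of_mem _ hx))
      fun hx => List.mem_append_right _ hx
  have hzlt : ∀ x ∈ e₂' ++ f₂, x ≠ 0 → |z| ≤ |x| := by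
    intro x hx hx0
    rcases List.mem_append.mp hx with hx | hx
    · have hpw := hee
      rw [hI.he, IsExpansion, List.pairwise_append, List.pairwise_cons] at hpw
      exact ((hpw.2.1.1 x hx).abs_lt le_rfl hx0).le
    · exact hzle x hx hx0
  have hle' : ∀ y ∈ (e₁ ++ [z]) ++ f₁, ∀ x ∈ e₂' ++ f₂, x ≠ 0 → |y| ≤ |x| := by
    intro y hy x hx hx0
    rcases List.mem_append.mp hy with hy | hy
    · rcases List.mem_append.mp hy with hy | hy
      · exact hI.hle y (List.mem_append_left _ hy) x (hsub x hx) hx0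
      · rw [List.mem_singleton.mp hy]; exact hzlt x hx hx0
    · exact hI.hle y (List.mem_append_right _ hy) x (hsub x hx) hx0
  have hGulp' : ∀ x ∈ e₂' ++ f₂, x ≠ 0 → (2 : ℚ) ^ G ≤ ulp p emin x := fun x hx =>
    hI.hGulp x (hsub x hx)
  by_cases hz0 : z = 0
  · -- a zero component: `(R, h) = (q, 0)`, `(Q', q') = (Q, q)`
    subst hz0
    simp only [fastTwoSum_zero_left hfl hI.hq, twoSum_eq_of_fl_add_eq hfl hI.hQ hI.hq hI.hfix]
    refine ⟨G, ⟨he', hI.hf, hI.hQ, hI.hq, hI.hfix, ?_, hle', ?_, ?_, hI.hG, hI.hQG, hI.hqG, ?_,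
      hGulp'⟩⟩
    · simpa using hI.hsum
    · intro x hx
      rcases List.mem_append.mp hx with hx | hx
      · exact hI.hhs x hx
      · rw [List.mem_singleton.mp hx]; exact isFloat_zero p emin
    · rw [IsExpansion, List.pairwise_append]
      exact ⟨hI.hexp, List.pairwise_singleton _ _, fun a _ b hb => by
        rw [List.mem_singleton.mp hb]; exact below_zero_right 1 a⟩
    · intro x hx
      rcases List.mem_append.mp hx with hx | hx
      · exact hI.hhG x hx
      · rw [List.mem_singleton.mp hx, abs_zero]; exact zpow_pos h2 G
  · -- a nonzero component `z`, `ulp(z) = 2^k`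
    obtain ⟨k, hk, hku, hzk⟩ := exists_ulp_eq_two_zpow_and_onGrid hzF
    have hGk : (2 : ℚ) ^ G ≤ (2 : ℚ) ^ k := hku ▸ hI.hGulp z hzef hz0
    have hGk' : G ≤ k := (zpow_le_zpow_iff_right₀ (by norm_num : (1 : ℚ) < 2)).mp hGk
    -- `|q| ≤ ½ulp(Q) ≤ ulp(z) ≤ |z|`: FAST-TWO-SUM(z, q) is legitimate
    have hQz : |Q| < (2 : ℚ) ^ (Int.log 2 |z| + 2) := hI.abs_Q_lt hp hfl heF hee hfF hfe hzef hz0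
    have hulpQ : ulp p emin Q ≤ 2 * ulp p emin z := ulp_le_two_mul_ulp_of_abs_lt hz0 hQz
    have hqQ : |q| ≤ ulp p emin Q / 2 := hI.abs_q_le hp1 hfl
    have hqk : |q| ≤ (2 : ℚ) ^ k := by rw [← hku]; linarith
    have hkz : (2 : ℚ) ^ k ≤ |z| := hzk.two_zpow_le_abs hz0
    have hqz : |q| ≤ |z| := hqk.trans hkz
    obtain ⟨hR, -, hh, hRh⟩ := fastTwoSum_exact hp1 hfl hzF hI.hq hqz
    set R : ℚ := (fastTwoSum fl z q).1 with hRdef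
    set h : ℚ := (fastTwoSum fl z q).2 with hhdef
    have hRF : IsFloat p emin R := (isFloat_fastTwoSum hfl z q).1
    have hhF : IsFloat p emin h := (isFloat_fastTwoSum hfl z q).2
    -- `|z + q| < 2^k (2^p + 1)`, so `|h| < 2^k = ulp(z)` (Lemma 3 / Corollary 8(a))
    have hzq : |z + q| < (2 : ℚ) ^ k * (2 ^ p + 1) := by
      have h1 : |z| < 2 ^ p * ulp p emin z := abs_lt_two_pow_mul_ulp z
      rw [hku] at h1
      calc |z + q| ≤ |z| + |q| := abs_add_le z q
        _ < 2 ^ p * (2 : ℚ) ^ k + (2 : ℚ) ^ k := by linarith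
        _ = (2 : ℚ) ^ k * (2 ^ p + 1) := by ring
    have hhk : |h| < (2 : ℚ) ^ k := by rw [hh]; exact abs_err_lt_two_zpow hp1 hfl hk hzq
    -- TWO-SUM(Q, R) is exact
    obtain ⟨hq'eq, hQ'q'⟩ := twoSum_exact hp1 hfl hI.hQ hRF
    have hQ'eq : (twoSum fl Q R).1 = fl (Q + R) := twoSum_fst fl Q R
    set Q' : ℚ := (twoSum fl Q R).1 with hQ'def
    set q' : ℚ := (twoSum fl Q R).2 with hq'def
    have hQ'F : IsFloat p emin Q' := (isFloat_twoSum hfl Q R).1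
    have hq'F : IsFloat p emin q' := (isFloat_twoSum hfl Q R).2
    have hfix' : fl (Q' + q') = Q' := by rw [hQ'q', ← hQ'eq]
    have hsum' : Q' + q' + (hs ++ [h]).sum = (e₁ ++ [z]).sum + f₁.sum := by
      rw [List.sum_append, List.sum_singleton, List.sum_append, List.sum_singleton, hQ'q']
      have := hI.hsum
      linear_combination this + hRh
    have hhs' : ∀ x ∈ hs ++ [h], IsFloat p emin x := by
      intro x hx
      rcases List.mem_append.mp hx with hx | hx
      · exact hI.hhs x hx
      · rw [List.mem_singleton.mp hx]; exact hhF
    -- `z, q ∈ 2^G·ℤ`, hence `R`, `h` too: the earlier outputs lie below `h`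
    have hzqG : OnGrid G (z + q) := (hzk.mono hGk').add hI.hqG
    have hRG : OnGrid G R := by rw [hR]; exact hzqG.fl_of hp1 hfl hI.hG
    have hhG : OnGrid G h := by rw [hh]; exact hzqG.sub (hzqG.fl_of hp1 hfl hI.hG)
    have hexp' : IsExpansion 1 (hs ++ [h]) := by
      rw [IsExpansion, List.pairwise_append]
      exact ⟨hI.hexp, List.pairwise_singleton _ _, fun a ha b hb => by
        rw [List.mem_singleton.mp hb]; exact ⟨G, hhG, by rw [one_mul]; exact hI.hhG a ha⟩⟩
    by_cases hh0 : h = 0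
    · -- a zero output: the grid stays `2^G`
      have hQRG : OnGrid G (Q + R) := hI.hQG.add hRG
      have hQ'G : OnGrid G Q' := by rw [hQ'eq]; exact hQRG.fl_of hp1 hfl hI.hG
      have hq'G : OnGrid G q' := by rw [hq'eq]; exact hQRG.sub (hQRG.fl_of hp1 hfl hI.hG)
      refine ⟨G, ⟨he', hI.hf, hQ'F, hq'F, hfix', hsum', hle', hhs', hexp', hI.hG, hQ'G, hq'G, ?_,
        hGulp'⟩⟩
      intro x hx
      rcases List.mem_append.mp hx with hx | hx
      · exact hI.hhG x hx
      · rw [List.mem_singleton.mp hx, hh0, abs_zero]; exact zpow_pos h2 G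
    · -- a nonzero output `h`, `2^T ≤ |h| < 2^(T+1)`: the new grid is `2^(T+1)`
      set T : ℤ := Int.log 2 |h| with hTdef
      have hTh : (2 : ℚ) ^ T ≤ |h| := zpow_log_le_abs hh0
      have hhT : |h| < (2 : ℚ) ^ (T + 1) := abs_lt_zpow_log_succ h
      have hGT : G ≤ T := by
        have : (2 : ℚ) ^ G < (2 : ℚ) ^ (T + 1) := lt_of_le_of_lt (hhG.two_zpow_le_abs hh0) hhT
        have := (zpow_lt_zpow_iff_right₀ (by norm_num : (1 : ℚ) < 2)).mp this
        omega
      have hTk : T + 1 ≤ k := by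
        have := (zpow_lt_zpow_iff_right₀ (by norm_num : (1 : ℚ) < 2)).mp (lt_of_le_of_lt hTh hhk)
        omega
      have heT : emin ≤ T + 1 := by have := hI.hG; omega
      -- `R = fl(z + q) ∈ 2^(T+1)·ℤ` because its roundoff `h` is at least `2^T`
      have hRT : OnGrid (T + 1) R := by
        obtain ⟨s, hs, hlt⟩ := below_one_sub_fl hp1 hfl (z + q)
        rw [one_mul, ← hh] at hlt
        have hTs : T + 1 ≤ s := by
          have := (zpow_lt_zpow_iff_right₀ (by norm_num : (1 : ℚ) < 2)).mp (lt_of_le_of_lt hTh hlt)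
          omega
        rw [hR]; exact hs.mono hTs
      -- `Q ∈ 2^(T+1)·ℤ` because `2^T ≤ |h| ≤ |q| ≤ ½ulp(Q)` (Lemma 1)
      have hQT : OnGrid (T + 1) Q := by
        obtain ⟨kQ, -, hkQu, hQkQ⟩ := exists_ulp_eq_two_zpow_and_onGrid hI.hQ
        have hhq : |h| ≤ |q| := by rw [hh, abs_sub_comm]; exact (abs_err_add_le hfl hzF hI.hq).2
        have : (2 : ℚ) ^ (T + 1) ≤ (2 : ℚ) ^ kQ := by
          rw [← hkQu, zpow_add_one₀ h2.ne']; linarith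
        exact hQkQ.mono ((zpow_le_zpow_iff_right₀ (by norm_num : (1 : ℚ) < 2)).mp this)
      have hQRT : OnGrid (T + 1) (Q + R) := hQT.add hRT
      have hQ'T : OnGrid (T + 1) Q' := by rw [hQ'eq]; exact hQRT.fl_of hp1 hfl heT
      have hq'T : OnGrid (T + 1) q' := by rw [hq'eq]; exact hQRT.sub (hQRT.fl_of hp1 hfl heT)
      refine ⟨T + 1, ⟨he', hI.hf, hQ'F, hq'F, hfix', hsum', hle', hhs', hexp', heT, hQ'T, hq'T, ?_,
        ?_⟩⟩
      · intro x hx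
        rcases List.mem_append.mp hx with hx | hx
        · exact lt_of_lt_of_le (hI.hhG x hx) (zpow_le_zpow_right₀ (by norm_num) (by omega))
        · rw [List.mem_singleton.mp hx]; exact hhT
      · intro x hx hx0
        calc (2 : ℚ) ^ (T + 1) ≤ (2 : ℚ) ^ k := zpow_le_zpow_right₀ (by norm_num) hTk
          _ = ulp p emin z := hku.symm
          _ ≤ ulp p emin x := ulp_mono (hzlt x hx hx0)

/-- **THEOREM 24 by induction over the loop**: from any state satisfying the invariant, the
outputs so far followed by the loop's outputs on the remaining merged components form a
nonoverlapping increasing expansion summing to `e + f` (at the end, `q = (Q + q) − fl(Q + q)` lies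
below `Q = fl(Q + q)`, and both lie on the final grid, above every earlier output).
[cite: Shewchuk1997, Thm 24 p. 361–362 (proof)] -/
theorem LesInv.isExpansion_lesLoop (hp : 3 ≤ p) (hfl : IsRoundNearest p emin fl)
    {e f : List ℚ} (heF : ∀ x ∈ e, IsFloat p emin x) (hee : IsExpansion 1 e)
    (hfF : ∀ x ∈ f, IsFloat p emin x) (hfe : IsExpansion 1 f) :
    ∀ (rs e₁ f₁ e₂ f₂ : List ℚ) (Q q : ℚ) (hs : List ℚ) (G : ℤ), mergeExpansions e₂ f₂ = rs →
      LesInv p emin fl e f e₁ f₁ e₂ f₂ Q q hs G →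
        IsExpansion 1 (hs ++ lesLoop fl rs Q q) ∧
          (hs ++ lesLoop fl rs Q q).sum = e.sum + f.sum := by
  have hp1 : 1 ≤ p := le_trans (by norm_num) hp
  intro rs
  induction rs with
  | nil =>
    intro e₁ f₁ e₂ f₂ Q q hs G hm hI
    have hlen := length_mergeExpansions e₂ f₂
    rw [hm, List.length_nil] at hlen
    have he₂ : e₂ = [] := List.eq_nil_of_length_eq_zero (by omega)
    have hf₂ : f₂ = [] := List.eq_nil_of_length_eq_zero (by omega)
    rw [lesLoop_nil]
    refine ⟨?_, ?_⟩
    · rw [IsExpansion, List.pairwise_append]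
      refine ⟨hI.hexp, ?_, fun a ha b hb => ?_⟩
      · rw [List.pairwise_pair]
        have := below_one_sub_fl hp1 hfl (Q + q)
        rwa [hI.hfix, add_sub_cancel_left] at this
      · have hb' : OnGrid G b := by
          rcases List.mem_pair.mp hb with rfl | rfl
          exacts [hI.hqG, hI.hQG]
        exact ⟨G, hb', by rw [one_mul]; exact hI.hhG a ha⟩
    · have h1 := hI.hsum
      have h2 : e.sum + f.sum = e₁.sum + f₁.sum := by
        rw [hI.he, hI.hf, he₂, hf₂, List.append_nil, List.append_nil]
      rw [h2, List.sum_append]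
      simp only [List.sum_cons, List.sum_nil, add_zero]
      linarith
  | cons z rs ih =>
    intro e₁ f₁ e₂ f₂ Q q hs G hm hI
    rw [lesLoop_cons]
    -- after the step (by `e` or by `f`), we are again in a state satisfying the invariant
    have key : ∃ (e₁' f₁' e₂' f₂' : List ℚ) (G' : ℤ), mergeExpansions e₂' f₂' = rs ∧
        LesInv p emin fl e f e₁' f₁' e₂' f₂' (twoSum fl Q (fastTwoSum fl z q).1).1
          (twoSum fl Q (fastTwoSum fl z q).1).2 (hs ++ [(fastTwoSum fl z q).2]) G' := by
      rcases mergeExpansions_eq_cons hm with ⟨e₂', rfl, hrs, hhead⟩ | ⟨f₂', rfl, hrs, hhead⟩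
      · -- `z` is the next component of `e`
        have hzle : ∀ x ∈ f₂, x ≠ 0 → |z| ≤ |x| := by
          intro x hx hx0
          cases f₂ with
          | nil => simp at hx
          | cons y ys =>
            have hzy := hhead y ys rfl
            rcases List.mem_cons.mp hx with rfl | hx
            · exact hzy
            · have hpw := hfe
              rw [hI.hf, IsExpansion, List.pairwise_append, List.pairwise_cons] at hpw
              exact le_trans hzy ((hpw.2.1.1 x hx).abs_lt le_rfl hx0).le
        obtain ⟨G', hI'⟩ := hI.step hp hfl heF hee hfF hfe hzle
        exact ⟨_, _, _, _, G', hrs.symm, hI'⟩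
      · -- `z` is the next component of `f`: the same step with the roles of `e` and `f` exchanged
        have hzle : ∀ x ∈ e₂, x ≠ 0 → |z| ≤ |x| := by
          intro x hx hx0
          cases e₂ with
          | nil => simp at hx
          | cons y ys =>
            have hzy := hhead y ys rfl
            rcases List.mem_cons.mp hx with rfl | hx
            · exact hzy.le
            · have hpw := hee
              rw [hI.he, IsExpansion, List.pairwise_append, List.pairwise_cons] at hpw
              exact le_trans hzy.le ((hpw.2.1.1 x hx).abs_lt le_rfl hx0).le
        obtain ⟨G', hI'⟩ := hI.swap.step hp hfl hfF hfe heF hee hzle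
        exact ⟨_, _, _, _, G', hrs.symm, hI'.swap⟩
    obtain ⟨e₁', f₁', e₂', f₂', G', hrs, hI'⟩ := key
    have := ih e₁' f₁' e₂' f₂' _ _ _ G' hrs hI'
    simpa only [List.append_assoc, List.singleton_append] using this

/-! ### Theorem 24 -/

/-- **THEOREM 24 (LINEAR-EXPANSION-SUM), for ANY round-to-nearest, `p ≥ 3`, gradual underflow.**
"Let `e = Σᵢ₌₁^m eᵢ` and `f = Σᵢ₌₁ⁿ fᵢ` be nonoverlapping expansions of `m` and `n` `p`-bit
components, respectively, where `p ≥ 3`. Suppose that the components of both `e` and `f` are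
sorted in order of increasing magnitude, except that any of the `eᵢ` or `fᵢ` may be zero. Then
[LINEAR-EXPANSION-SUM] will produce a nonoverlapping expansion `h` such that
`h = Σᵢ₌₁^{m+n} hᵢ = e + f`, where the components of `h` are also in order of increasing magnitude,
except that any of the `hᵢ` may be zero."  (Nonoverlapping and increasing except zeros =
`IsExpansion 1`; the components are floats.) [cite: Shewchuk1997, Thm 24 p. 360–361] -/
theorem linearExpansionSum_nonoverlapping (hp : 3 ≤ p) (hfl : IsRoundNearest p emin fl)
    {e f : List ℚ} (heF : ∀ x ∈ e, IsFloat p emin x) (hee : IsExpansion 1 e)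
    (hfF : ∀ x ∈ f, IsFloat p emin x) (hfe : IsExpansion 1 f) :
    IsExpansion 1 (linearExpansionSum fl e f) ∧ (linearExpansionSum fl e f).sum = e.sum + f.sum ∧
      (linearExpansionSum fl e f).length = e.length + f.length ∧
      ∀ x ∈ linearExpansionSum fl e f, IsFloat p emin x := by
  have hp1 : 1 ≤ p := le_trans (by norm_num) hp
  obtain ⟨hexp, hsum⟩ := LesInv.isExpansion_lesLoop hp hfl heF hee hfF hfe (mergeExpansions e f)
    [] [] e f 0 0 [] emin rfl (LesInv.init hfl e f)
  rw [List.nil_append, lesLoop_merge_zero_zero hp1 hfl heF hfF (hee.pairwise_abs_le le_rfl)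
    (hfe.pairwise_abs_le le_rfl)] at hexp hsum
  refine ⟨(isExpansion_cons.mp (isExpansion_cons.mp hexp).2).2, by simpa using hsum,
    length_linearExpansionSum fl e f, isFloat_of_mem_linearExpansionSum hfl heF hfF⟩

/-- **THEOREM 24, the sum**: "after Lines 6 and 7 are executed, `Σⱼ₌₁^{m+n} hⱼ = Σⱼ₌₁^{m+n} gⱼ`,
so the algorithm produces a correct sum" — `Σ hᵢ = e + f`.
[cite: Shewchuk1997, Thm 24 p. 361 (proof, first invariant)] -/
theorem sum_linearExpansionSum (hp : 3 ≤ p) (hfl : IsRoundNearest p emin fl)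
    {e f : List ℚ} (heF : ∀ x ∈ e, IsFloat p emin x) (hee : IsExpansion 1 e)
    (hfF : ∀ x ∈ f, IsFloat p emin x) (hfe : IsExpansion 1 f) :
    (linearExpansionSum fl e f).sum = e.sum + f.sum :=
  (linearExpansionSum_nonoverlapping hp hfl heF hee hfF hfe).2.1

/-- THEOREM 24, the nonoverlapping property in the paper's own words (`Nonoverlapping` in the sense
of §2.1 between any two output components). [cite: Shewchuk1997, Thm 24 p. 360–361; §2.1 p. 309] -/
theorem linearExpansionSum_pairwise_nonoverlapping (hp : 3 ≤ p) (hfl : IsRoundNearest p emin fl)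
    {e f : List ℚ} (heF : ∀ x ∈ e, IsFloat p emin x) (hee : IsExpansion 1 e)
    (hfF : ∀ x ∈ f, IsFloat p emin x) (hfe : IsExpansion 1 f) :
    (linearExpansionSum fl e f).Pairwise Nonoverlapping :=
  (linearExpansionSum_nonoverlapping hp hfl heF hee hfF hfe).1.imp fun hab => hab.nonoverlapping

/-- THEOREM 24 under IEEE round-to-nearest-even in particular (the theorem assumes NO tie rule;
this is the instance `fl = roundTiesEven p emin`). [cite: Shewchuk1997, Thm 24 p. 360–361] -/
theorem linearExpansionSum_nonoverlapping_roundTiesEven (hp : 3 ≤ p) {e f : List ℚ}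
    (heF : ∀ x ∈ e, IsFloat p emin x) (hee : IsExpansion 1 e)
    (hfF : ∀ x ∈ f, IsFloat p emin x) (hfe : IsExpansion 1 f) :
    IsExpansion 1 (linearExpansionSum (roundTiesEven p emin) e f) ∧
      (linearExpansionSum (roundTiesEven p emin) e f).sum = e.sum + f.sum ∧
      (linearExpansionSum (roundTiesEven p emin) e f).length = e.length + f.length ∧
      ∀ x ∈ linearExpansionSum (roundTiesEven p emin) e f, IsFloat p emin x :=
  linearExpansionSum_nonoverlapping hp (isRoundNearest_roundTiesEven (le_trans (by norm_num) hp))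
    heF hee hfF hfe

end Literature.ComputerArithmetic.Shewchuk1997
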